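import Summits.QuantumFields.YangMills.Theorems.UnitScaleTiltProp7FramedSecondDifference
import Summits.QuantumFields.YangMills.Theorems.UnitScaleTiltProp7PinnedHarmonicMass
import Literature.MathematicalPhysics.QuantumFieldTheory.Balaban1983to89.B9Eq375Composition
import Literature.MathematicalPhysics.QuantumFieldTheory.Balaban1983to89.B9Ineq373HessianPieceBoundsY
import HarnessLib

/-!
# Route `UnitScaleTilt`, crux K1 «MinimiserStabilityRegPr» (stmt-QuantumFields-19200), route-R E′ path (α′), (E1-b) covariant, row (hK₂-cov) — LETTER «FRAMED-LAPLACIAN»: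
# THE COVARIANT LAPLACIAN IN A FRAME — `R(Fr x)⁻¹(Δ_UV)(x) = Δ_h v(x)` EXACTLY (`v = R(Fr⁻¹)V`, `h_μ = Fr⁻¹·U_μ·Fr(·+e_μ)`), and the comparison with the FLAT Laplacian of the framed field,
# `‖Δ_h v(x) − Δ₁v(x)‖ ≤ Σ_μ [2‖h_μ(x) − 1‖·‖v(x+e_μ) − v(x−e_μ)‖ + (2‖h_μ(x) − h_μ(x−e_μ)‖ + 4‖h_μ(x−e_μ) − 1‖²)·‖v(x−e_μ)‖]` — FIRST differences of `v` only

Cell `ym3-torus`, width seat `ym3-torus-px11` (gen 3), LEAD of the (hK₂-cov) chain (routeR-w3 g6 WORDS (8)–(10), 2026-08-28T21:58:57Z); LOCATE 19200 evidence #57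
`LOCATE-HK2COV-px11g3.md` §1 rows (Q)(PIN), §2 «why τ₂ is needed».  `--kind proof --supports stmt-QuantumFields-19200 --as helper`, count-neutral.  THEOREMS ONLY (0 `def`, 0 `sorry`).
YM₃ on T³ is a ladder rung (R3) — not d = 4, not infinite volume, not a mass gap, not the Clay problem; nothing here claims the stub, the crux or the gap.

THE POINT (numbers).  The (Q)∕(PIN) rows of (hK₂-cov) run px7 g3's flat texts (✓p673007 `…InterpErrorPinAbstract`) on the framed field `v := R(Fr⁻¹)V` of `V := Δ_Uφ_H`
in px4 g3's ball frame (✓p672574 `exists_ballFrame_of_regPr`: `‖h_μ − 1‖ ≤ τ₁ ≍ e∕ℓ`, `‖h_μ(·+e_ν) − h_μ‖ ≤ τ₂ ≍ e∕ℓ²`).  The junk `f := Δ_h v − Δ₁v` must be `O(e)`-relative AT THE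
SCALING OF `Δ`: the crude comparison `‖f‖ ≤ 4dτ₁·max‖v‖` loses one power of `ℓ`; the rewrite
`(R(h_μ x) − 1)v₊ + (R(h_μ(x−e_μ))⁻¹ − 1)v₋ = (R(h_μ x) − 1)(v₊ − v₋) + (R(h_μ x) − R(h_μ(x−e_μ)))v₋ + (R(g) + R(g⁻¹) − 2)v₋` (`g = h_μ(x−e_μ)`), with
`R(g)X + R(g⁻¹)X − 2X = (a+b)X + X(a+b) + aXb + bXa`, `a = g − 1`, `b = g⁻¹ − 1`, `a + b = g⁻¹(g−1)²`, puts `τ₁` on a FIRST DIFFERENCE of `v` and `τ₂ + τ₁²` on `v` itself — both at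
the right power (LOCATE #57 §2).

WHAT IS PROVED (ns `…Theorems.Prop7FramedCovLaplacian`).
* §1 (any ring; abstract carrier `S`, shifts `T : ι → Equiv.Perm S`, units `U`, frame `Fr`) ★ `R_inv_frame_covLaplace` — `R(Fr x)⁻¹(divB T U (D_U e))(x) = divB T h (D_h v)(x)`, exact.
* §2 (normed ring, bi-contractive units) `norm_R_add_R_inv_sub_two_le` (`‖R(g)X + R(g⁻¹)X − (X+X)‖ ≤ 4‖g − 1‖²‖X‖`), `covLaplace_sub_flat_eq` (the rewrite, exact),
  ★★ `norm_covLaplace_sub_flat_le` (the comparison of the title, raw norms) and ★★ `norm_covLaplace_sub_flat_le_of_rows` (with `τ₁ τ₂`: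
  `≤ Σ_μ [2τ₁‖v(T_μx) − v(T_μ⁻¹x)‖ + (2τ₂ + 4τ₁²)‖v(T_μ⁻¹x)‖]`).
* §3 (torus `Site P i`, matrix fields, `L²`-operator norm) ★★ `norm_covLaplace_sub_laplace_one_le_T` — the same with the flat part identified as `LatticeFieldCalculus.laplace 1 v x`.
HONEST SCOPE.  Pointwise algebra and norm bookkeeping ([folklore]; [Balaban1985BackgroundPropagators] (3.28) for the framed bond variables); frames and their rows stay hypotheses
(supplied at the member by ✓p672574); the (Q)∕(PIN) rows are F3-cov.

References: T. Bałaban, CMP 99 (1985) 389–434 [Balaban1985BackgroundPropagators] ((3.3) p.390, (3.8) p.392, (3.28) p.395, (3.35) p.396); CMP 102 (1985) 277–309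
[Balaban1985Variational] (Prop. 7 p.299).
-/

set_option autoImplicit false

noncomputable section

open scoped BigOperators

namespace Summit.QuantumFields.YangMills.Theorems.Prop7FramedCovLaplacian

open Literature.MathematicalPhysics.QuantumFieldTheory.Balaban1983to89
open B9Eq39Adjoint (R R_def R_sub R_add R_inv_R covD covDstar divB)
open B11Eq135Weitzenbock (norm_R_sub_self_le)
open B9Ineq373HessianPieceBoundsY (norm_R_sub_R_le)
open B9Eq375Composition (R_sum)
open Summit.QuantumFields.YangMills.Theorems.Prop7FramedSecondDifference (R_inv_frame_covD)

/-! ## §1 The covariant Laplacian in a frame (any ring) -/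

section RingLevel

variable {𝔸 : Type*} [Ring 𝔸] {S : Type*} {ι : Type*} [Fintype ι] (T : ι → Equiv.Perm S) (U : ι → S → 𝔸ˣ) (Fr : S → 𝔸ˣ)

/-- ★ **GAUGE COVARIANCE OF `Δ_U = D^*_UD_U` UNDER A FRAME**: `R(Fr x)⁻¹ (D^*_U D_U e)(x) = (D^*_h D_h v)(x)` for `v = R(Fr⁻¹)e`, `h_μ(z) = Fr(z)⁻¹·U_μ(z)·Fr(T_μz)`.
[cite: Balaban1985BackgroundPropagators, (3.28) p.395, (3.8) p.392] -/
theorem R_inv_frame_covLaplace (e : S → 𝔸) (x : S) :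
    R (Fr x)⁻¹ (divB T U (fun μ => covD T U μ e) x)
      = divB T (fun κ z => (Fr z)⁻¹ * U κ z * Fr (T κ z))
          (fun μ => covD T (fun κ z => (Fr z)⁻¹ * U κ z * Fr (T κ z)) μ (fun z => R (Fr z)⁻¹ (e z))) x := by
  simp only [divB, R_sum]
  refine Finset.sum_congr rfl fun μ _ => ?_
  simp only [covDstar, R_sub]
  congr 1
  · -- the transported backward term
    set y := (T μ).symm x with hy
    have hx : T μ y = x := by rw [hy, Equiv.apply_symm_apply]
    rw [← R_inv_frame_covD T U Fr e μ y, ← B9Eq39Adjoint.R_mul, ← B9Eq39Adjoint.R_mul]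
    congr 1
    rw [mul_inv_rev, mul_inv_rev, inv_inv, hx, mul_assoc, mul_assoc, mul_inv_cancel, mul_one]
  · exact R_inv_frame_covD T U Fr e μ x

end RingLevel

/-! ## §2 The comparison with the flat Laplacian of the framed field (normed ring, bi-contractive units) -/

section NormLevel

variable {𝔸 : Type} [NormedRing 𝔸] {S : Type*} {ι : Type*} [Fintype ι] (T : ι → Equiv.Perm S) (V : ι → S → 𝔸ˣ)

omit [Fintype ι] T V in
/-- **`R(g) + R(g⁻¹) − 2` IS SECOND ORDER**: `‖R(g)X + R(g⁻¹)X − (X + X)‖ ≤ 4‖g − 1‖²‖X‖` for a unit with `‖g⁻¹‖ ≤ 1`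
(`gXg⁻¹ + g⁻¹Xg − 2X = (a+b)X + X(a+b) + aXb + bXa`, `a = g − 1`, `b = g⁻¹ − 1 = −g⁻¹a`, `a + b = g⁻¹a²`). [folklore] -/
theorem norm_R_add_R_inv_sub_two_le {g : 𝔸ˣ} (hg : ‖((g⁻¹ : 𝔸ˣ) : 𝔸)‖ ≤ 1) (X : 𝔸) :
    ‖R g X + R g⁻¹ X - (X + X)‖ ≤ 4 * ‖(g : 𝔸) - 1‖ ^ 2 * ‖X‖ := by
  set a : 𝔸 := (g : 𝔸) - 1 with ha
  set b : 𝔸 := ((g⁻¹ : 𝔸ˣ) : 𝔸) - 1 with hb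
  have hga : (g : 𝔸) = 1 + a := by rw [ha]; abel
  have hgb : ((g⁻¹ : 𝔸ˣ) : 𝔸) = 1 + b := by rw [hb]; abel
  have e : R g X + R g⁻¹ X - (X + X) = (a + b) * X + X * (a + b) + a * X * b + b * X * a := by
    rw [R_def, R_def, inv_inv, hga, hgb]; noncomm_ring
  -- `b = −g⁻¹a`, `a + b = g⁻¹a·a`... as norms: `‖b‖ ≤ ‖a‖`, `‖a + b‖ ≤ ‖a‖²`
  have hb' : b = -(((g⁻¹ : 𝔸ˣ) : 𝔸) * a) := by
    rw [hb, ha, mul_sub, mul_one, Units.inv_mul]; abel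
  have hga' : ((g⁻¹ : 𝔸ˣ) : 𝔸) * a = 1 - ((g⁻¹ : 𝔸ˣ) : 𝔸) := by rw [ha, mul_sub, mul_one, Units.inv_mul]
  have hab : a + b = ((g⁻¹ : 𝔸ˣ) : 𝔸) * a * a := by
    rw [hb', hga', sub_mul, one_mul, hga']; abel
  have hnb : ‖b‖ ≤ ‖a‖ := by
    rw [hb', norm_neg]
    calc ‖((g⁻¹ : 𝔸ˣ) : 𝔸) * a‖ ≤ ‖((g⁻¹ : 𝔸ˣ) : 𝔸)‖ * ‖a‖ := norm_mul_le _ _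
      _ ≤ 1 * ‖a‖ := by gcongr
      _ = ‖a‖ := one_mul _
  have hnab : ‖a + b‖ ≤ ‖a‖ ^ 2 := by
    rw [hab]
    calc ‖((g⁻¹ : 𝔸ˣ) : 𝔸) * a * a‖ ≤ ‖((g⁻¹ : 𝔸ˣ) : 𝔸)‖ * ‖a‖ * ‖a‖ :=
          (norm_mul_le _ _).trans (mul_le_mul_of_nonneg_right (norm_mul_le _ _) (norm_nonneg _))
      _ ≤ 1 * ‖a‖ * ‖a‖ := by gcongr
      _ = ‖a‖ ^ 2 := by ring
  rw [e]
  have h1 : ‖(a + b) * X‖ ≤ ‖a‖ ^ 2 * ‖X‖ := (norm_mul_le _ _).trans (mul_le_mul_of_nonneg_right hnab (norm_nonneg _))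
  have h2 : ‖X * (a + b)‖ ≤ ‖a‖ ^ 2 * ‖X‖ := by
    calc ‖X * (a + b)‖ ≤ ‖X‖ * ‖a + b‖ := norm_mul_le _ _
      _ ≤ ‖X‖ * ‖a‖ ^ 2 := mul_le_mul_of_nonneg_left hnab (norm_nonneg _)
      _ = ‖a‖ ^ 2 * ‖X‖ := mul_comm _ _
  have h3 : ‖a * X * b‖ ≤ ‖a‖ ^ 2 * ‖X‖ := by
    calc ‖a * X * b‖ ≤ ‖a‖ * ‖X‖ * ‖b‖ := (norm_mul_le _ _).trans (mul_le_mul_of_nonneg_right (norm_mul_le _ _) (norm_nonneg _))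
      _ ≤ ‖a‖ * ‖X‖ * ‖a‖ := by gcongr
      _ = ‖a‖ ^ 2 * ‖X‖ := by ring
  have h4 : ‖b * X * a‖ ≤ ‖a‖ ^ 2 * ‖X‖ := by
    calc ‖b * X * a‖ ≤ ‖b‖ * ‖X‖ * ‖a‖ := (norm_mul_le _ _).trans (mul_le_mul_of_nonneg_right (norm_mul_le _ _) (norm_nonneg _))
      _ ≤ ‖a‖ * ‖X‖ * ‖a‖ := by gcongr
      _ = ‖a‖ ^ 2 * ‖X‖ := by ring
  calc ‖(a + b) * X + X * (a + b) + a * X * b + b * X * a‖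
      ≤ ‖(a + b) * X‖ + ‖X * (a + b)‖ + ‖a * X * b‖ + ‖b * X * a‖ := by
        refine (norm_add_le _ _).trans (add_le_add ((norm_add_le _ _).trans (add_le_add (norm_add_le _ _) le_rfl)) le_rfl)
    _ ≤ _ := by linarith

/-- **THE REWRITE** (exact, any background): with `y := T_μ⁻¹x`,
`Δ_V v(x) − Σ_μ(v x + v x − v(T_μx) − v(y)) = −Σ_μ [(R(V_μx)(v(T_μx) − v y) − (v(T_μx) − v y)) + (R(V_μx) v y − R(V_μ y) v y) + (R(V_μ y) v y + R(V_μ y)⁻¹ v y − (v y + v y))]`.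
[cite: Balaban1985BackgroundPropagators, (3.8) p.392] -/
theorem covLaplace_sub_flat_eq (v : S → 𝔸) (x : S) :
    divB T V (fun μ => covD T V μ v) x - ∑ μ, (v x + v x - v (T μ x) - v ((T μ).symm x))
      = -∑ μ, ((R (V μ x) (v (T μ x) - v ((T μ).symm x)) - (v (T μ x) - v ((T μ).symm x)))
          + (R (V μ x) (v ((T μ).symm x)) - R (V μ ((T μ).symm x)) (v ((T μ).symm x)))
          + (R (V μ ((T μ).symm x)) (v ((T μ).symm x)) + R (V μ ((T μ).symm x))⁻¹ (v ((T μ).symm x))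
              - (v ((T μ).symm x) + v ((T μ).symm x)))) := by
  rw [divB, ← Finset.sum_sub_distrib, ← Finset.sum_neg_distrib]
  refine Finset.sum_congr rfl fun μ _ => ?_
  simp only [covDstar, covD, R_sub, R_inv_R, Equiv.apply_symm_apply]
  abel

/-- ★★ **COVARIANT vs FLAT LAPLACIAN OF THE FRAMED FIELD, raw norms** (bi-contractive background `V`): with `y_μ := T_μ⁻¹x`,
`‖Δ_V v(x) − Σ_μ(v x + v x − v(T_μx) − v(y_μ))‖ ≤ Σ_μ [2‖V_μx − 1‖·‖v(T_μx) − v(y_μ)‖ + (2‖V_μx − V_μy_μ‖ + 4‖V_μy_μ − 1‖²)·‖v(y_μ)‖]`.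
[cite: Balaban1985BackgroundPropagators, (3.8) p.392, (3.35) p.396] -/
theorem norm_covLaplace_sub_flat_le (hV : ∀ (κ : ι) (y : S), ‖(V κ y : 𝔸)‖ ≤ 1 ∧ ‖(((V κ y)⁻¹ : 𝔸ˣ) : 𝔸)‖ ≤ 1) (v : S → 𝔸) (x : S) :
    ‖divB T V (fun μ => covD T V μ v) x - ∑ μ, (v x + v x - v (T μ x) - v ((T μ).symm x))‖
      ≤ ∑ μ, (2 * ‖(V μ x : 𝔸) - 1‖ * ‖v (T μ x) - v ((T μ).symm x)‖
          + (2 * ‖(V μ x : 𝔸) - (V μ ((T μ).symm x) : 𝔸)‖ + 4 * ‖(V μ ((T μ).symm x) : 𝔸) - 1‖ ^ 2) * ‖v ((T μ).symm x)‖) := by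
  rw [covLaplace_sub_flat_eq, norm_neg]
  refine (norm_sum_le _ _).trans (Finset.sum_le_sum fun μ _ => ?_)
  set y := (T μ).symm x with hy
  have h1 := norm_R_sub_self_le (hV μ x).2 (v (T μ x) - v y)
  have h2 := norm_R_sub_R_le (hV μ x) (hV μ y) (v y)
  have h3 := norm_R_add_R_inv_sub_two_le (hV μ y).2 (v y)
  calc _ ≤ ‖R (V μ x) (v (T μ x) - v y) - (v (T μ x) - v y)‖ + ‖R (V μ x) (v y) - R (V μ y) (v y)‖
          + ‖R (V μ y) (v y) + R (V μ y)⁻¹ (v y) - (v y + v y)‖ :=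
        (norm_add_le _ _).trans (add_le_add ((norm_add_le _ _).trans le_rfl) le_rfl)
    _ ≤ 2 * ‖(V μ x : 𝔸) - 1‖ * ‖v (T μ x) - v y‖ + 2 * ‖(V μ x : 𝔸) - (V μ y : 𝔸)‖ * ‖v y‖ + 4 * ‖(V μ y : 𝔸) - 1‖ ^ 2 * ‖v y‖ := by
        linarith
    _ = _ := by ring

/-- ★★ **COVARIANT vs FLAT LAPLACIAN OF THE FRAMED FIELD, with rows** (bi-contractive `V`; at the site `x`: `‖V_μx − 1‖ ≤ τ₁`, `‖V_μ(T_μ⁻¹x) − 1‖ ≤ τ₁`,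
`‖V_μx − V_μ(T_μ⁻¹x)‖ ≤ τ₂` for every `μ`):
`‖Δ_V v(x) − Σ_μ(v x + v x − v(T_μx) − v(T_μ⁻¹x))‖ ≤ Σ_μ [2τ₁·‖v(T_μx) − v(T_μ⁻¹x)‖ + (2τ₂ + 4τ₁²)·‖v(T_μ⁻¹x)‖]` — FIRST differences of `v` only.
[cite: Balaban1985BackgroundPropagators, (3.8) p.392, (3.35) p.396] -/
theorem norm_covLaplace_sub_flat_le_of_rows (hV : ∀ (κ : ι) (y : S), ‖(V κ y : 𝔸)‖ ≤ 1 ∧ ‖(((V κ y)⁻¹ : 𝔸ˣ) : 𝔸)‖ ≤ 1)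
    (v : S → 𝔸) (x : S) {τ₁ τ₂ : ℝ}
    (h1 : ∀ μ, ‖(V μ x : 𝔸) - 1‖ ≤ τ₁) (h1' : ∀ μ, ‖(V μ ((T μ).symm x) : 𝔸) - 1‖ ≤ τ₁)
    (h2 : ∀ μ, ‖(V μ x : 𝔸) - (V μ ((T μ).symm x) : 𝔸)‖ ≤ τ₂) :
    ‖divB T V (fun μ => covD T V μ v) x - ∑ μ, (v x + v x - v (T μ x) - v ((T μ).symm x))‖
      ≤ ∑ μ, (2 * τ₁ * ‖v (T μ x) - v ((T μ).symm x)‖ + (2 * τ₂ + 4 * τ₁ ^ 2) * ‖v ((T μ).symm x)‖) := by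
  refine (norm_covLaplace_sub_flat_le T V hV v x).trans (Finset.sum_le_sum fun μ _ => ?_)
  have hτ₁ : 0 ≤ τ₁ := (norm_nonneg _).trans (h1 μ)
  have hsq : ‖(V μ ((T μ).symm x) : 𝔸) - 1‖ ^ 2 ≤ τ₁ ^ 2 := pow_le_pow_left₀ (norm_nonneg _) (h1' μ) 2
  gcongr
  · exact h1 μ
  · exact h2 μ

end NormLevel

/-! ## §3 The torus reading: matrix fields, `L²`-operator norm, flat part = `LatticeFieldCalculus.laplace 1` -/

section Torus

open scoped Matrix.Norms.L2Operator
open LatticeFieldCalculus (laplace)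
open B9TorusCalculus (torusT torusT_apply torusT_symm_apply)

variable {P : Params} {i : ℕ} {N : ℕ}

/-- ★★ **ON THE TORUS**: for a background `V` of bi-contractive matrix units on `T^{(i)}` with `‖V_μx − 1‖ ≤ τ₁`, `‖V_μ(x−e_μ) − 1‖ ≤ τ₁`, `‖V_μx − V_μ(x−e_μ)‖ ≤ τ₂` at `x`:
`‖(D^*_VD_V v)(x) − (laplace 1 v)(x)‖ ≤ Σ_μ [2τ₁·‖v(x+e_μ) − v(x−e_μ)‖ + (2τ₂ + 4τ₁²)·‖v(x−e_μ)‖]` (read it with `V :=` the framed links `Fr⁻¹·U·Fr(·+e_μ)` of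
✓ `exists_ballFrame_of_regPr` and `v := R(Fr⁻¹)(Δ_Uφ_H)`, §1). [cite: Balaban1985BackgroundPropagators, (3.8) p.392, (3.35) p.396] -/
theorem norm_covLaplace_sub_laplace_one_le_T (V : Fin P.d → Site P i → (Matrix (Fin N) (Fin N) ℂ)ˣ)
    (hV : ∀ (κ : Fin P.d) (y : Site P i), ‖(V κ y : Matrix (Fin N) (Fin N) ℂ)‖ ≤ 1 ∧ ‖(((V κ y)⁻¹ : (Matrix (Fin N) (Fin N) ℂ)ˣ) : Matrix (Fin N) (Fin N) ℂ)‖ ≤ 1)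
    (v : Site P i → Matrix (Fin N) (Fin N) ℂ) (x : Site P i) {τ₁ τ₂ : ℝ}
    (h1 : ∀ μ, ‖(V μ x : Matrix (Fin N) (Fin N) ℂ) - 1‖ ≤ τ₁) (h1' : ∀ μ, ‖(V μ (x.unshift μ) : Matrix (Fin N) (Fin N) ℂ) - 1‖ ≤ τ₁)
    (h2 : ∀ μ, ‖(V μ x : Matrix (Fin N) (Fin N) ℂ) - (V μ (x.unshift μ) : Matrix (Fin N) (Fin N) ℂ)‖ ≤ τ₂) :
    ‖divB (torusT P i) V (fun μ => covD (torusT P i) V μ v) x - laplace 1 v x‖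
      ≤ ∑ μ : Fin P.d, (2 * τ₁ * ‖v (x.shift μ) - v (x.unshift μ)‖ + (2 * τ₂ + 4 * τ₁ ^ 2) * ‖v (x.unshift μ)‖) := by
  have hflat : laplace 1 v x = ∑ μ : Fin P.d, (v x + v x - v (torusT P i μ x) - v ((torusT P i μ).symm x)) := by
    simp only [laplace, one_pow, one_smul, torusT_apply, torusT_symm_apply]
  rw [hflat]
  have h := norm_covLaplace_sub_flat_le_of_rows (torusT P i) V hV v x (τ₁ := τ₁) (τ₂ := τ₂)
    (fun μ => h1 μ) (fun μ => by rw [torusT_symm_apply]; exact h1' μ) (fun μ => by rw [torusT_symm_apply]; exact h2 μ)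
  simpa only [torusT_apply, torusT_symm_apply] using h

end Torus

end Summit.QuantumFields.YangMills.Theorems.Prop7FramedCovLaplacian

end
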